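import Summits.CriticalPhenomena.SAWScalingLimit.Theorems.SAWReversalUpgradeAttachReversalPrelimB
import Summits.CriticalPhenomena.SAWScalingLimit.Theorems.SAWReversalUpgradeAttachReversalInvariance

/-!
# Attachment reversal: exact time reversal, part A (times, pushed arc, directions, rays)

Helper file for item `AttachReversal` of route `SAWReversalUpgrade` (stmt-CriticalPhenomena-18007).
Fix a Dobrushin domain `(D; a, b)`, chordal uniformizers `φ` of `D` and `φ'` of `D.swap = (D; b, a)`
with `φ' = φ ∘ ι_c` on `ℍ` (`ι_c z = -1/(c z)`), boundary extensions `Φ`, `Φ'`, a squeeze angle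
`0 < e ≤ 1/2`, and a continuous `U : ℝ → ℂ` with values in `closure D`; put `U' u = U (1 - u)` (exact
time reversal). For the attachment data of `(a, b, Φ, e, U)` (unprimed) and of `(b, a, Φ', e, U')`
(primed, the data the route computes in `D.swap` for the reversed polyline) we prove:

* `rev_lastA`, `rev_firstB` — `i' = 1 - j`, `j' = 1 - i` (generic);
* `rev_attZ`, `rev_midSet` — `Z' u = Z (1 - u)`, `M' = M`;
* `rev_pAcc`, `rev_qEx` — the primed directions are `A_e (ψ' (U j))`, `A_e (ψ' (U i))`;
* `bExt_swap_ray` — `Φ' (ρ · ι q) = Φ (ρ⁻¹ · q)` (`q ∈ ℍ`, `ρ > 0`): rays from `0` and rays to `∞` are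
  exchanged, the identity behind "access segment of the reversal = exit ray of the original".
-/

noncomputable section

open Set Function Filter Topology Complex
open UpperHalfPlane (upperHalfPlaneSet)
open Literature.Probability.RandomPlanarGeometry

namespace Summit.CriticalPhenomena.SAWScalingLimit.Theorems.AttachReversal

/-! ### Time reversal of the visit times (generic) -/

section Generic

variable {x : ℂ} {U : ℝ → ℂ}

/-- The constrained visit set of the reversed curve is the reflection of the visit set. -/
theorem image_one_sub_sep (x : ℂ) (U : ℝ → ℂ) :
    (fun t : ℝ => 1 - t) '' {t | t ∈ Icc (0:ℝ) 1 ∧ U t = x} =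
      {u | u ∈ Icc (0:ℝ) 1 ∧ U (1 - u) = x} := by
  ext u
  simp only [mem_image, mem_setOf_eq, mem_Icc]
  constructor
  · rintro ⟨t, ⟨⟨ht0, ht1⟩, htx⟩, rfl⟩
    exact ⟨⟨by linarith, by linarith⟩, by rwa [sub_sub_cancel]⟩
  · rintro ⟨⟨hu0, hu1⟩, hux⟩
    exact ⟨1 - u, ⟨⟨by linarith, by linarith⟩, hux⟩, sub_sub_cancel 1 u⟩

/-- **`i' = 1 - j`**: the last visit of `x` by the reversed curve is one minus the first visit of
`x` by the curve. -/
theorem rev_lastA (x : ℂ) (U : ℝ → ℂ) : lastA x (fun u => U (1 - u)) = 1 - firstB x U := by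
  have hanti : Antitone fun t : ℝ => 1 - t := fun s t hst => by linarith
  have hne : ({(1:ℝ)} ∪ {t | t ∈ Icc (0:ℝ) 1 ∧ U t = x}).Nonempty := ⟨1, Or.inl rfl⟩
  have h := hanti.map_csInf_of_continuousAt (continuous_sub_left (1:ℝ)).continuousAt hne
    (firstBSet_bddBelow x U)
  unfold lastA firstB
  rw [h, image_union, image_singleton, sub_self, image_one_sub_sep]

/-- **`j' = 1 - i`**. -/
theorem rev_firstB (x : ℂ) (U : ℝ → ℂ) : firstB x (fun u => U (1 - u)) = 1 - lastA x U := by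
  have hanti : Antitone fun t : ℝ => 1 - t := fun s t hst => by linarith
  have hne : ({(0:ℝ)} ∪ {t | t ∈ Icc (0:ℝ) 1 ∧ U t = x}).Nonempty := ⟨0, Or.inl rfl⟩
  have h := hanti.map_csSup_of_continuousAt (continuous_sub_left (1:ℝ)).continuousAt hne
    (lastASet_bddAbove x U)
  unfold lastA firstB
  rw [h, image_union, image_singleton, sub_zero, image_one_sub_sep]

/-- The reflection `u ↦ 1 - u` maps the primed trimmed interval onto the unprimed one. -/
theorem image_one_sub_Icc_rev (x y : ℂ) (U : ℝ → ℂ) :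
    (fun t : ℝ => 1 - t) '' Icc (lastA y (fun u => U (1 - u))) (firstB x (fun u => U (1 - u))) =
      Icc (lastA x U) (firstB y U) := by
  rw [rev_lastA, rev_firstB, image_const_sub_Icc, sub_sub_cancel, sub_sub_cancel]

/-- The primed trimmed interval is nonempty iff the unprimed one is. -/
theorem rev_le_iff (x y : ℂ) (U : ℝ → ℂ) :
    lastA y (fun u => U (1 - u)) ≤ firstB x (fun u => U (1 - u)) ↔ lastA x U ≤ firstB y U := by
  rw [rev_lastA, rev_firstB]
  constructor <;> intro h <;> linarith

end Generic

/-! ### The common setting -/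

variable {D : DobrushinDomain} {φ : ConformalEquiv upperHalfPlaneSet D.carrier}
  {φ' : ConformalEquiv upperHalfPlaneSet D.swap.carrier} {c e : ℝ} {U : ℝ → ℂ}

/-- **`Z' u = Z (1 - u)`**: the pushed polyline of the reversed curve in the swapped domain is the
time reversal of the pushed polyline. -/
theorem rev_attZ (hφ : D.IsChordalUniformizing φ) (hφ' : D.swap.IsChordalUniformizing φ') (hc : 0 < c)
    (heq : ∀ z ∈ upperHalfPlaneSet, φ' z = φ (-((c : ℂ) * z)⁻¹)) (he : 0 < e) (he' : e ≤ 1 / 2)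
    (hcl : ∀ s, U s ∈ closure D.carrier) (u : ℝ) :
    attZ (D.pt 0) φ'.boundaryExtension e (fun u => U (1 - u)) u =
      attZ (D.pt 1) φ.boundaryExtension e U (1 - u) :=
  pushVal_swap hφ hφ' hc heq he he' (hcl (1 - u))

/-- **`M' = M`**: the pushed middle arcs coincide. -/
theorem rev_midSet (hφ : D.IsChordalUniformizing φ) (hφ' : D.swap.IsChordalUniformizing φ') (hc : 0 < c)
    (heq : ∀ z ∈ upperHalfPlaneSet, φ' z = φ (-((c : ℂ) * z)⁻¹)) (he : 0 < e) (he' : e ≤ 1 / 2)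
    (hcl : ∀ s, U s ∈ closure D.carrier) :
    midSet (D.pt 1) (D.pt 0) φ'.boundaryExtension e (fun u => U (1 - u)) =
      midSet (D.pt 0) (D.pt 1) φ.boundaryExtension e U := by
  unfold midSet
  have hZ : attZ (D.pt 0) φ'.boundaryExtension e (fun u => U (1 - u)) =
      attZ (D.pt 1) φ.boundaryExtension e U ∘ fun t : ℝ => 1 - t :=
    funext fun u => rev_attZ hφ hφ' hc heq he he' hcl u
  rw [hZ, image_comp, image_one_sub_Icc_rev]

/-- The primed access direction is `A_e (ψ' (U j))`. -/
theorem rev_pAcc (e : ℝ) (U : ℝ → ℂ) :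
    pAcc (D.pt 1) φ'.boundaryExtension e (fun u => U (1 - u)) =
      squeeze e (hinv φ'.boundaryExtension (U (firstB (D.pt 1) U))) := by
  unfold pAcc
  simp only [rev_lastA, sub_sub_cancel]

/-- The primed exit direction is `A_e (ψ' (U i))`. -/
theorem rev_qEx (e : ℝ) (U : ℝ → ℂ) :
    qEx (D.pt 0) φ'.boundaryExtension e (fun u => U (1 - u)) =
      squeeze e (hinv φ'.boundaryExtension (U (lastA (D.pt 0) U))) := by
  unfold qEx
  simp only [rev_firstB, sub_sub_cancel]

/-- The primed guard point `U' j'` is `U i`. -/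
theorem rev_guard (U : ℝ → ℂ) :
    (fun u => U (1 - u)) (firstB (D.pt 0) fun u => U (1 - u)) = U (lastA (D.pt 0) U) := by
  simp only [rev_firstB, sub_sub_cancel]

/-! ### Rays are exchanged by the inversion -/

/-- For `q ∈ ℍ` and `ρ > 0`: `ρ · ι q = ι (ρ⁻¹ · q)` and hence **`Φ' (ρ · ι q) = Φ (ρ⁻¹ · q)`**. -/
theorem bExt_swap_ray (hc : 0 < c) (heq : ∀ z ∈ upperHalfPlaneSet, φ' z = φ (-((c : ℂ) * z)⁻¹))
    {q : ℂ} (hq : 0 < q.im) {ρ : ℝ} (hρ : 0 < ρ) :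
    φ'.boundaryExtension ((ρ : ℂ) * -((c : ℂ) * q)⁻¹) = φ.boundaryExtension (((ρ⁻¹ : ℝ) : ℂ) * q) := by
  have hw : 0 < ((((ρ⁻¹ : ℝ) : ℂ)) * q).im := ray_im_pos hq (inv_pos.2 hρ)
  have hw0 : (((ρ⁻¹ : ℝ) : ℂ)) * q ≠ 0 := by
    intro h; rw [h] at hw; simp at hw
  have hι : (ρ : ℂ) * -((c : ℂ) * q)⁻¹ = -((c : ℂ) * ((((ρ⁻¹ : ℝ) : ℂ)) * q))⁻¹ := by
    rw [negInv_real_mul, inv_inv]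
  rw [hι, bExt_swap_eq hc heq (negInv_im_nonneg hc hw.le) (negInv_ne_zero hc.ne' hw0),
    negInv_negInv hc.ne']

/-- The ray map `s ↦ Φ (s · p)` is continuous on `[0, ∞)` for `p ∈ ℍ̄`. -/
theorem continuousOn_ray (φ : ConformalEquiv upperHalfPlaneSet D.carrier) {p : ℂ} (hp : 0 ≤ p.im) :
    ContinuousOn (fun s : ℝ => φ.boundaryExtension ((s : ℂ) * p)) (Ici 0) :=
  ray_continuousOn (continuousOn_boundaryExtension_im_nonneg φ) hp

/-- Along a ray of `ℍ̄ ∖ {0}`, `Φ (r · q) → b`. -/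
theorem tendsto_ray_pt_one (hφ : D.IsChordalUniformizing φ) {q : ℂ} (hq : 0 ≤ q.im) (hq0 : q ≠ 0) :
    Tendsto (fun r : ℝ => φ.boundaryExtension ((r : ℂ) * q)) atTop (𝓝 (D.pt 1)) :=
  ray_tendsto_pt hφ.tendsto_boundaryExtension_cocompact hq hq0

/-- At the origin of a ray, `Φ (s · p) → Φ 0 = a` as `s → 0⁺`. -/
theorem tendsto_ray_pt_zero (hφ : D.IsChordalUniformizing φ) {p : ℂ} (hp : 0 ≤ p.im) :
    Tendsto (fun s : ℝ => φ.boundaryExtension ((s : ℂ) * p)) (𝓝[≥] 0) (𝓝 (D.pt 0)) := by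
  have h := (continuousOn_ray φ hp) 0 (by simp)
  rw [ContinuousWithinAt, Complex.ofReal_zero, zero_mul, hφ.boundaryExtension_zero] at h
  exact h

/-! ### The polyline endpoints and the visit times -/

/-- If the trimmed interval does not start at a visit of `a`, it starts at time `0`. -/
theorem lastA_eq_zero_of_ne (hU : Continuous U) (h : U (lastA (D.pt 0) U) ≠ D.pt 0) :
    lastA (D.pt 0) U = 0 := by
  rcases lastA_spec hU (D.pt 0) with h' | h'
  · exact h'
  · exact (h h').elim

/-- If the trimmed interval does not end at a visit of `b`, it ends at time `1`. -/
theorem firstB_eq_one_of_ne (hU : Continuous U) (h : U (firstB (D.pt 1) U) ≠ D.pt 1) :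
    firstB (D.pt 1) U = 1 := by
  rcases firstB_spec hU (D.pt 1) with h' | h'
  · exact h'
  · exact (h h').elim

/-- The directions of the attachment lie in `ℍ̄`; off the marked points they lie in `ℍ`. -/
theorem squeeze_hinv_im_pos (hφ : D.IsChordalUniformizing φ) (he : 0 < e) (he' : e ≤ 1 / 2) {w : ℂ}
    (hw : w ∈ closure D.carrier) (hwa : w ≠ D.pt 0) (hwb : w ≠ D.pt 1) :
    0 < (squeeze e (hinv φ.boundaryExtension w)).im :=
  sqz_im_pos he he' (squeeze_spec' e) (hinv_im_nonneg hφ hw hwb) (invFunOn_bExt_ne_zero hφ hw hwb hwa)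

/-- `Z j = Φ q` when the trimmed interval does not end at `b` (with `q` the exit direction). -/
theorem attZ_firstB_of_ne {e : ℝ} (h : U (firstB (D.pt 1) U) ≠ D.pt 1) :
    attZ (D.pt 1) φ.boundaryExtension e U (firstB (D.pt 1) U) =
      φ.boundaryExtension (qEx (D.pt 1) φ.boundaryExtension e U) := by
  unfold qEx; exact attZ_of_ne h

/-- `Z i = Φ p` when... always off `b` at `i` provided `U i ≠ b` (with `p` the access direction). -/
theorem attZ_lastA_of_ne {e : ℝ} (h : U (lastA (D.pt 0) U) ≠ D.pt 1) :
    attZ (D.pt 1) φ.boundaryExtension e U (lastA (D.pt 0) U) =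
      φ.boundaryExtension (pAcc (D.pt 0) φ.boundaryExtension e U) := by
  unfold pAcc; exact attZ_of_ne h

end Summit.CriticalPhenomena.SAWScalingLimit.Theorems.AttachReversal

end
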